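import Mathlib
import Literature.NumberTheory.Sieve.FordMaynardFramework

/-!
# Route `FordMaynardSieveConst01651`, target `SieveConst01651` (stmt-Parity-19185), line `sieve_decomposition`:
# helpers towards `stub_typeIIRegion` — a convex-polytope condition on `(log pᵢ / log n)` as a finite product of
# flagged threshold indicators

Ford–Maynard (proof of Proposition 7.22): "the conditions `𝐯(p₁⋯p_k; n) ∈ 𝒯`, … are all systems of linear
inequalities in the components of `𝐯`", each of which becomes, after multiplying by `log n > 0`, a condition
`∑ cᵢ log pᵢ < b log n` or `≤` — i.e. one entry of the flagged list consumed by
`…ShellSeparationMany.bilin_thresholds_shell_flag`.  This file does that bookkeeping once: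

* `mem_setOf_faces_div_iff` — for `L > 0`, `(yᵢ / L)ᵢ` satisfies the faces `S` (strict), `T` (non-strict) of
  Definition 5.7 iff `∑ cᵢ yᵢ < b L` (`c ∈ S`) and `∑ cᵢ yᵢ ≤ b L` (`c ∈ T`).
* `ite_forall_mem_list_eq_prod` — `𝟙[∀ c ∈ l, q c] = ∏_{c ∈ l} 𝟙[q c]` (as complex numbers) for a list `l`;
  `ite_and_eq_mul` — `𝟙[P ∧ Q] = 𝟙[P] 𝟙[Q]`.
* `indicator_faces_eq_prod` — `𝟙[(yᵢ/L) ∈ {faces S, T}]` is the product over the flagged list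
  `S.toList.map (·, strict) ++ T.toList.map (·, non-strict)` of the indicators `𝟙[∑ cᵢ yᵢ < b L]` / `𝟙[… ≤ …]`.

Def-free. Nothing here proves anything about the Parity summit; helpers for the Type-II region stub of one leaf.
-/

open Finset

namespace Summit.Parity.GeneralizedHardyLittlewood.FordMaynardSieveConst01651SieveConst01651

/-- Scaling the faces of Definition 5.7 by `L > 0`: `(yᵢ/L)ᵢ` satisfies `c · x < b` iff `c · y < b L`, and the same
with `≤`. [cite: FordMaynard2024PrimeSieves, Definition 5.7 and proof of Proposition 7.22] -/
theorem mem_setOf_faces_div_iff {k : ℕ} (S T : Finset ((Fin k → ℝ) × ℝ)) {L : ℝ} (hL : 0 < L)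
    (y : Fin k → ℝ) :
    (fun i => y i / L) ∈ {x : Fin k → ℝ | (∀ c ∈ S, ∑ i, c.1 i * x i < c.2) ∧ ∀ c ∈ T, ∑ i, c.1 i * x i ≤ c.2} ↔
      (∀ c ∈ S, ∑ i, c.1 i * y i < c.2 * L) ∧ ∀ c ∈ T, ∑ i, c.1 i * y i ≤ c.2 * L := by
  have hsum : ∀ c : (Fin k → ℝ) × ℝ, ∑ i, c.1 i * (y i / L) = (∑ i, c.1 i * y i) / L := by
    intro c
    rw [Finset.sum_div]
    exact Finset.sum_congr rfl fun i _ => by ring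
  simp only [Set.mem_setOf_eq, hsum, div_lt_iff₀ hL, div_le_iff₀ hL]

/-- `𝟙[P ∧ Q] = 𝟙[P] · 𝟙[Q]` in `ℂ`. [folklore] -/
theorem ite_and_eq_mul (P Q : Prop) [Decidable P] [Decidable Q] :
    (if P ∧ Q then (1 : ℂ) else 0) = (if P then (1 : ℂ) else 0) * (if Q then (1 : ℂ) else 0) := by
  by_cases hP : P <;> by_cases hQ : Q <;> simp [hP, hQ]

/-- `𝟙[∀ c ∈ l, q c] = ∏_{c ∈ l} 𝟙[q c]` in `ℂ`, for a list `l`. [folklore] -/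
theorem ite_forall_mem_list_eq_prod {α : Type*} (l : List α) (q : α → Prop) [DecidablePred q] :
    (if (∀ c ∈ l, q c) then (1 : ℂ) else 0) = (l.map fun c => if q c then (1 : ℂ) else 0).prod := by
  induction l with
  | nil => simp
  | cons a l ih =>
    rw [List.map_cons, List.prod_cons, ← ih]
    by_cases ha : q a <;> by_cases hl : ∀ c ∈ l, q c <;> simp [ha, hl]

/-- **A polytope condition as a product of flagged threshold indicators.** For faces `S` (strict) and `T`
(non-strict) and `L > 0`, the indicator of `(yᵢ/L)ᵢ ∈ {x : c·x < b (c ∈ S), c·x ≤ b (c ∈ T)}` equals the product,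
over the flagged list `S.toList.map (fun c => (c, true)) ++ T.toList.map (fun c => (c, false))`, of
`𝟙[∑ cᵢ yᵢ < b L]` (flag `true`) resp. `𝟙[∑ cᵢ yᵢ ≤ b L]` (flag `false`) — ready for
`…ShellSeparationMany.bilin_thresholds_shell_flag` once `∑ cᵢ yᵢ` and `b L = b log n = b (log m + log ∏t)` are
split into a function of the short variable and one of the tuple.
[cite: FordMaynard2024PrimeSieves, Definition 5.7 and proof of Proposition 7.22 / Lemma 7.11] -/
theorem indicator_faces_eq_prod {k : ℕ} (S T : Finset ((Fin k → ℝ) × ℝ)) {L : ℝ} (hL : 0 < L)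
    (y : Fin k → ℝ) :
    (if (fun i => y i / L) ∈
        {x : Fin k → ℝ | (∀ c ∈ S, ∑ i, c.1 i * x i < c.2) ∧ ∀ c ∈ T, ∑ i, c.1 i * x i ≤ c.2}
      then (1 : ℂ) else 0) =
      ((S.toList.map (fun c => (c, true)) ++ T.toList.map (fun c => (c, false))).map
        fun p : ((Fin k → ℝ) × ℝ) × Bool =>
          if (if p.2 then ∑ i, p.1.1 i * y i < p.1.2 * L else ∑ i, p.1.1 i * y i ≤ p.1.2 * L)
            then (1 : ℂ) else 0).prod := by
  classical
  have hiff : ((fun i => y i / L) ∈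
        {x : Fin k → ℝ | (∀ c ∈ S, ∑ i, c.1 i * x i < c.2) ∧ ∀ c ∈ T, ∑ i, c.1 i * x i ≤ c.2}) ↔
      ((∀ c ∈ S.toList, ∑ i, c.1 i * y i < c.2 * L) ∧ ∀ c ∈ T.toList, ∑ i, c.1 i * y i ≤ c.2 * L) := by
    rw [mem_setOf_faces_div_iff S T hL y]
    simp only [Finset.mem_toList]
  rw [if_congr hiff rfl rfl, ite_and_eq_mul, ite_forall_mem_list_eq_prod, ite_forall_mem_list_eq_prod,
    List.map_append, List.prod_append, List.map_map, List.map_map]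
  congr 1

end Summit.Parity.GeneralizedHardyLittlewood.FordMaynardSieveConst01651SieveConst01651
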